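import Literature.MathematicalPhysics.QuantumFieldTheory.Balaban1983to89.B8LeafKnitZd3E
import Literature.MathematicalPhysics.QuantumFieldTheory.Balaban1983to89.B8Prop6CubeMemberExists

/-!
# `Balaban1983to89.B8Thm4HalvesZd3` — [Balaban1985RegularSpaces] THEOREM 4 (p. 88) IN ITS TWO PRINTED HALVES on the N05 family of record
# `B8LeafModelZd3.zdGF3`: the EXISTENCE half `B8.Thm4ExistsBody cₑ` modulo the three existence sockets, the UNIQUENESS half
# `B8.Thm4UniqueBody c_u` («exactly one») modulo Proposition 5's repaired uniqueness socket alone, and `B8.Thm4Printed` reassembled from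
# the halves (`B8.thm4Printed_of_halves`) — index-mapped (`ι : J → ZdIdx d L`), sockets on the image of `ι` only

statement-level skeleton of published theorems with citation tags; proofs where landed; nothing here is a claim about the
Yang–Mills mass gap

T. Bałaban, *Spaces of regular gauge field configurations on a lattice and gauge fixing conditions*, Commun. Math. Phys. **99**
(1985) 75–102 `[Balaban1985RegularSpaces]` ("B8"), Theorem 4 p. 88 («there exists exactly one gauge transformation u …»), proof
pp. 88–95 (existence pp. 88–94, uniqueness p. 95).  PDF held: `paper:balaban1985-cmp99-regular-spaces-gauge-fixing` (journal page = PDF page + 74).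

CITATION HEADER (lean-in-tree rule).  Cell `pub-ymgap` (YM Track A, HUMAN RULING D-0062), DAG node N05 = [B8], seat `pub-ymgap-dag-n05-c`
(g2).  Director-ym R134 row s1 for this seat, verbatim: «Thm 4 EXISTENCE half `Thm4ExistsBody cₑ` → Thm 2 via `B8.thm2_of_thm4_prop3`».
The landed N05 lineage packages Theorem 4 on the family of record WHOLE (`B8LeafModelZd3.thm4Printed_zd3(_of_HFP₄)`,
`B8LeafKnitZd3E.thm4Printed_zd3_mapE` — FOUR sockets, existence and uniqueness inseparable).  THIS FILE types the director's currency: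
the two halves of `B8.lean` (`Thm4ExistsBody`, `Thm4UniqueBody`, `thm4Body_iff_halves`, `thm4Printed_of_halves`) ON `zdGF3`, each modulo
exactly the sockets it consumes —
* §1 **`thm4Unique_concrete_uniformE`** — the UNIQUENESS HALF on the concrete carriers with ONE uniform threshold `c_u(d, L, B₀, B₀′, cu, cP)`,
  member-generic over `(Ω, Λs)` with the tower∕partition laws `htower`∕`hpart` (no `Λb`, no `hbox`∕`hclass`): two unitary `u₁, u₂` carried by
  `Ω₀` with (1.29), (1.38) and the (1.62)-shape for `U′^{u_i⁻¹}` coincide — MODULO Proposition 5's repaired uniqueness socket `SockP5uE` ALONE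
  (the uniqueness tail of `pub-ymgap-dag-n05-a`'s `B8Thm4ConcreteE.thm4Body_concrete_uniformE` verbatim: `B8Thm4Windows.thm4_windows`∕`_extra`,
  `B8Thm4UniqueE.thm4_unique_eq_landau138E`).  (The existence half's uniform driver is `B8Prop6CubeMemberExists.thm4Exists_concrete_uniform`.)
* §2 AT ONE MEMBER of `zdGF3` (sockets inside, the pattern of `B8LeafKnitZd3E.thm4Body_member_zd3E`): **`thm4ExistsBody_member_zd3`** (three
  sockets `SockP5base`∕`SockP5`∕`SockH59`; (1.37) via the canonical masked exponent `mlogCfg` and the (1.42) lemma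
  `B8Eq142KLevelLocal.H42_of_inAx`, exactly as the landed whole-theorem assembly) and **`thm4UniqueBody_member_zd3E`** (one socket `SockP5uE`).
* §3 ON AN INDEX-MAPPED SUB-FAMILY `fam₃ ∘ ι`: **`thm4ExistsBody_zd3_map`** ∕ `_of_HFP_map` ∕ `_of_HFP₃_map` (fixed-point currency
  `SockHFP₀`∕`SockHFP`∕`SockH59`, common or independent thresholds), **`thm4UniqueBody_zd3_mapE`**, and **`thm4Printed_zd3_of_halvesE`** =
  `B8.Thm4Printed (5dLB₀)` on `zdGF3` REASSEMBLED from the halves by `B8.thm4Printed_of_halves` (consistency of the split; the index-mapped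
  whole theorem is `B8LeafKnitZd3E.thm4Printed_zd3_mapE`, cited not restated).
WHY THE SPLIT MATTERS (located, junction flags J2∕W8): the existence half is served on EVERY law-abiding member — including the concrete cube
members of Proposition 6 (`Ω₀ = □₀`, `B8CubeMemberIdxB8Laws.exists_member_cube_sub`) — while the only provider of the uniqueness socket
(`B8SockP5uEAssembly.sockP5uE_body_of_join`, `pub-ymgap-dag-n04-b`) is scoped to `Ω₀ = T_η` members; keying the two halves separately lets
each half be discharged on exactly the sub-family its providers serve.

HONEST SCOPE.  Assemblies BY NAME over landed modules; nothing of Propositions 3∕5, (1.42), (1.59), (1.110)–(1.112) is proved here; the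
sockets are displayed hypotheses guarded by their thresholds; count-neutral; N05 NOT discharged; `T_η ↦ ℤᵈ`; one finite `T⁴` programme at
fixed `ε`, Bałaban as printed — nothing continuum ∕ ℝ⁴ ∕ OS ∕ mass-gap ∕ Clay.  No `sorry`, no `axiom`, no `instance`, no `notation`.
Unit `pub-ymgap-dag-n05-c` (g2), 2026-08-26.

SCOPE NOTE (v-scope, 2026-08-27, seat pub-ymgap-dag-n05-c g11; director-ym LINE №196; NO statement change).  Every hypothesis of this file that is a
(1.59)-type socket read over the typed constraint-bond class `B8CubeMemberZd.cubeLamB` ∕ `B8IdxB8LawsB.towerBonds` (`SockH59`-, `SockB9P3`-shaped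
binders: Theorem 4's ∕ Proposition 3's frame) is UNINHABITED at every nested member with `k ≥ 1` as soon as the socket is owed at the flat background
`U₀ = 1` (interior shell gauge modes — kernel certificates `B8Ineq159FlatShellModeVacuity` p572834, `B8SockB9P3ShellModeVacuityUniv` p576185; root
cause: the class has no crossing bond, `B8Ineq159FlatCubeMemberPrinted.towerBonds_inner_of_printTower`).  The theorems below stay TRUE (PASS-AS-DECLARED) and
are VACUOUS wherever such a socket is among their hypotheses; the repaired class is `B8Ineq159FlatCubeMemberPrinted.cubeLamBP` (print's (1.31)∕[B6] (2.3)),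
over which the consumers are being re-typed (edition γ).  Sockets over the SITE tower `cubeLamS` only (`SockHFP`, `SockP5u…`, the REAL families, the
𝒢-bound) are NOT affected.

-/

noncomputable section

open NormedSpace

namespace Literature.MathematicalPhysics.QuantumFieldTheory.Balaban1983to89.B8Thm4HalvesZd3

open Complex (I)
open MatrixLog B7Prop1Explicit B7Prop2Explicit B7Prop1Local B7Eq92Concrete
open B7Prop2Explicit (C0 c2')
open B7Prop3Flat (c3)
open B8Ineq132 (covDerivFwd InAk)
open B8Eq119TwistedAxial (Restr129 InAx)
open B8Eq184Proof (gaugeExp cfgExp)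
open B8Lemma1NonAbelian (mulCfg)
open B8Eq140Level (SideTouches)
open B8Eq146AExpansion (iEta)
open B7Prop4GeneralLevels (logCovIter linCovIter)
open B8Thm2LogB (blockTop)
open B8Ineq130 (tlo thi)
open B8Eq138LandauZd (IsLandau138W logCfg)
open B8Prop3GaugeFixedKLevel (mem_unitaryUnits_of_mgauge_eq)
open B8Thm4AtLandau138 (mgauge_mgauge_inv)
open B8Thm4UniqueE (thm4_unique_eq_landau138E)
open B8Thm4Concrete (mulCfg_eq_mul)
open B8Thm4Windows (thm4_windows thm4_windows_extra)
open B8LeafModelZd (SockP5base SockP5 SockH59 ZdIdx)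
open B8LeafModelZdSockP5uE (SockP5uE)
open B8LeafModelZdOfHFP (SockHFP₀ SockHFP windows4 sockP5base_of_sockHFP₀ sockP5_of_sockHFP sockH59_anti sockHFP₀_anti sockHFP_anti)
open B8LeafModelZd3 (mlogCfg mlogCfg_spec zdGF3)
open B8LeafKnitZd3E (sockP5uE_anti)
open B8Prop6CubeMemberExists (thm4Exists_concrete_uniform)

-- `Site` alone could resolve to the torus sites of `Setup.lean`; re-export the `ℤ^d` sites of `B7Prop1Explicit`.
export B7Prop1Explicit (Site)

variable {d : ℕ}

/-! ## §1 Theorem 4, UNIQUENESS HALF, on the concrete carriers — uniform threshold, one socket -/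

section Unique

variable {𝔸 : Type*} [CStarAlgebra 𝔸] [Nontrivial 𝔸]

/-- **THEOREM 4 (p. 88), UNIQUENESS HALF («exactly one», proof p. 95) ON THE CONCRETE `ℤᵈ × 𝔸` CARRIERS, MEMBER-GENERIC, ONE UNIFORM
THRESHOLD** — for the member `(Ω, Λs)` with the tower law `htower` and the partition law `hpart` of the top structure `Λs k`, ONE
`c_u(d, L, B₀, B₀′, cu, cP) > 0`; below it, for every datum with (1.33), (1.34) (+ axial gauge at every truncation), (1.35) box form, (1.66)₀,
ANY TWO unitary `u₁, u₂`, both `= 1` off `Ω₀`, both with (1.29) at `k` levels, whose `U′^{u_i⁻¹}` satisfy (1.38) of record and the (1.62)-shape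
`∃ A_i, U′^{u_i⁻¹} = e^{iηA_i}`, `|A_i| ≤ 5dLB₀(α₀ + α₁)(Lʲη)⁻¹` on the sides touching `Ω_j`, are EQUAL (`k ≥ 1`) — MODULO Proposition 5's repaired
uniqueness socket `SockP5uE` alone.  The uniqueness tail of `B8Thm4ConcreteE.thm4Body_concrete_uniformE` verbatim (windows `thm4_windows`∕`_extra`,
radius schedule `2000·d·c⋆ ≤ cu`, `B8Thm4UniqueE.thm4_unique_eq_landau138E`).
[cite: Balaban1985RegularSpaces, Thm 4 p.88 («exactly one»), proof p.95 (1.112), Prop. 5 (1.109) p.94, (1.29) p.81, (1.38) p.82, (1.62) p.87] -/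
theorem thm4Unique_concrete_uniformE (hd2 : 2 ≤ d) {L : ℕ} (hL : 2 ≤ L)
    {B₀ B₀' cu cP : ℝ} (hB₀ : 0 < B₀) (hB₀' : 0 < B₀') (hB : 2 ≤ 5 * (d : ℝ) * L * B₀) (hcu : 0 < cu) (hcP : 0 < cP) :
    ∃ c₁ : ℝ, 0 < c₁ ∧ ∀ (η : ℝ), 0 < η → ∀ (k : ℕ) (Ω : ℕ → Set (Site d)) (Λs : ℕ → ℕ → Set (Site d))
    (htower : ∀ j, j ≤ k → ∀ y ∈ Λs k j, ∀ x, InBox (tlo L y j) (thi L y j) x → x ∈ Ω j)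
    (hpart : ∀ x, x ∈ Ω 0 → ∃ j, j ≤ k ∧ ∃ y ∈ Λs k j, InBox (tlo L y j) (thi L y j) x)
    (SP5u : SockP5uE (𝔸 := 𝔸) L B₀ cP cu η k Ω Λs),
      ∀ α₀ α₁ : ℝ, 0 < α₀ → 0 < α₁ → α₀ + α₁ ≤ c₁ →
      ∀ U₀ U' : Site d → Fin d → 𝔸ˣ, (∀ x κ, U₀ x κ ∈ unitaryUnits 𝔸) → (∀ x κ, U' x κ ∈ unitaryUnits 𝔸) →
      InAk L k η α₀ Ω U₀ → InAk L k η α₀ Ω (mulCfg U' U₀) → (∀ m, m ≤ k → InAx L m (Λs m) U₀ (mulCfg U' U₀)) →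
      (∀ j, j ≤ k → ∀ (z : Site d) (μ : Fin d), (∀ x, InBox (loK L j z) (bondHiK L j z μ) x → x ∈ Ω j) →
        ‖(avgIter L (mulCfg U' U₀) j z μ : 𝔸) - (avgIter L U₀ j z μ : 𝔸)‖ ≤ α₁) →
      (∀ b ∈ {b : Site d × Fin d | SideTouches (Ω 0) b.1 b.2}, ‖((U' b.1 b.2 : 𝔸ˣ) : 𝔸) - 1‖ ≤ α₁) →
      ∀ u₁ u₂ : Site d → 𝔸ˣ,
      (∀ x, u₁ x ∈ unitaryUnits 𝔸) → (∀ x, x ∉ Ω 0 → u₁ x = 1) → Restr129 L k (Λs k) U₀ u₁ →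
      IsLandau138W L k η (Ω 0) (Λs k) U₀ (mgauge U₀ u₁⁻¹ U') →
      (∃ A₁ : Site d → Fin d → 𝔸, ∀ j, j ≤ k → ∀ (x : Site d) (κ : Fin d), SideTouches (Ω j) x κ →
        mgauge U₀ u₁⁻¹ U' x κ = cfgExp η A₁ x κ ∧ ‖A₁ x κ‖ ≤ (5 * (d : ℝ) * L * B₀ * (α₀ + α₁)) * ((L : ℝ) ^ j * η)⁻¹) →
      (∀ x, u₂ x ∈ unitaryUnits 𝔸) → (∀ x, x ∉ Ω 0 → u₂ x = 1) → Restr129 L k (Λs k) U₀ u₂ →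
      IsLandau138W L k η (Ω 0) (Λs k) U₀ (mgauge U₀ u₂⁻¹ U') →
      (∃ A₂ : Site d → Fin d → 𝔸, ∀ j, j ≤ k → ∀ (x : Site d) (κ : Fin d), SideTouches (Ω j) x κ →
        mgauge U₀ u₂⁻¹ U' x κ = cfgExp η A₂ x κ ∧ ‖A₂ x κ‖ ≤ (5 * (d : ℝ) * L * B₀ * (α₀ + α₁)) * ((L : ℝ) ^ j * η)⁻¹) →
      1 ≤ k → u₁ = u₂ := by
  have hL1 : 1 ≤ L := le_trans (by norm_num) hL
  have hd1 : 1 ≤ d := le_trans (by norm_num) hd2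
  have hd' : (1 : ℝ) ≤ d := by exact_mod_cast hd1
  obtain ⟨c₁, hc₁, hw⟩ := thm4_windows hd1 hL1 hB₀ hB₀' hB
  obtain ⟨c₂, hc₂, hw'⟩ := thm4_windows_extra (d := d) hL1
  -- the threshold for Proposition 5's uniqueness radius: `2000·d·c⋆ ≤ cu`
  obtain ⟨c₃, hc₃def⟩ : ∃ c₃ : ℝ, c₃ = cu / (2000 * d * (5 * d * L * B₀)) := ⟨_, rfl⟩
  have hc₃ : 0 < c₃ := by rw [hc₃def]; positivity
  refine ⟨min (min c₁ c₂) (min cP c₃), lt_min (lt_min hc₁ hc₂) (lt_min hcP hc₃), ?_⟩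
  intro η hη k Ω Λs htower hpart SP5u α₀ α₁ hα₀ hα₁ hS U₀ U' hU₀ hU' h33 h34 hAx h135 h66
    u₁ u₂ hu₁ hu₁S h129₁ hLan₁ h162₁ hu₂ hu₂S h129₂ hLan₂ h162₂ hk1
  have hS1 : α₀ + α₁ ≤ c₁ := hS.trans ((min_le_left _ _).trans (min_le_left _ _))
  have hS2 : α₀ + α₁ ≤ c₂ := hS.trans ((min_le_left _ _).trans (min_le_right _ _))
  have hSP : α₀ + α₁ ≤ cP := hS.trans ((min_le_right _ _).trans (min_le_left _ _))
  have hS3 : α₀ + α₁ ≤ c₃ := hS.trans ((min_le_right _ _).trans (min_le_right _ _))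
  obtain ⟨-, -, -, -, w5, w6, -, -, -, -, -, -, -, -, w15, w16, w17, w18⟩ :=
    hw α₀ α₁ hα₀ hα₁ hS1 (5 * (d : ℝ) * L * B₀ * (α₀ + α₁)) (8 * B₀' * (5 * (d : ℝ) * L * B₀) * (α₀ + α₁)) rfl rfl
  obtain ⟨-, w20⟩ := hw' α₀ α₁ hα₀ hα₁ hS2
  -- the windows of the uniqueness clause at `c := c⋆`, `α_P := α₀`, and Prop. 5's radius `cu`
  obtain ⟨cs, hcsdef⟩ : ∃ cs : ℝ, cs = 5 * (d : ℝ) * L * B₀ * (α₀ + α₁) := ⟨_, rfl⟩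
  have hcs0' : 0 ≤ cs := by rw [hcsdef]; positivity
  have h2000 : 2000 * (d : ℝ) * cs ≤ cu := by
    have hden : 0 < 2000 * (d : ℝ) * (5 * d * L * B₀) := by positivity
    have h := (le_div_iff₀ hden).1 (hS3.trans (le_of_eq hc₃def))
    have e : 2000 * (d : ℝ) * cs = (α₀ + α₁) * (2000 * d * (5 * d * L * B₀)) := by rw [hcsdef]; ring
    linarith
  have hcu₂ : 5 * cs < cu := by
    have h₁ : (1 : ℝ) * cs ≤ d * cs := mul_le_mul_of_nonneg_right hd' hcs0'
    have hdcs : 0 ≤ (d : ℝ) * cs := by positivity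
    linarith
  have hcu₁ : 2 * (2 * (40 * d * cs) + 2 * 1116 * (40 * d * cs) ^ 2) < cu := by
    have hx0 : 0 ≤ 40 * d * cs := by positivity
    have hx1 : 40 * d * cs ≤ 1 / 5000 := by rw [hcsdef]; exact w16
    have hsq : (40 * d * cs) ^ 2 ≤ 40 * d * cs * (1 / 5000) := by rw [sq]; exact mul_le_mul_of_nonneg_left hx1 hx0
    have hdcs : 0 ≤ (d : ℝ) * cs := by positivity
    linarith
  rw [hcsdef] at hcu₁ hcu₂ hcs0'
  exact thm4_unique_eq_landau138E hd2 hL hη hU₀ hU' hu₁ hu₂ hα₀ w5 w6 hcs0' w18 w17 w15 w16 hα₀ w5 w20 hcu₁ hcu₂ h33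
    (by rw [← mulCfg_eq_mul]; exact h34) (by rw [← mulCfg_eq_mul]; exact hAx k le_rfl) htower h129₁ h129₂ hLan₁ hLan₂ h162₁ h162₂
    (SP5u α₀ α₁ hα₀ hα₁ hSP U₀ U' hU₀ hU' h33 h34 hAx h135 h66 u₁ hu₁ hu₁S h129₁ hLan₁ h162₁) hpart hu₁S hu₂S

end Unique

/-! ## §2 The two halves AT ONE MEMBER of `zdGF3` (sockets inside) -/

section Member

variable {𝔸 : Type} [CStarAlgebra 𝔸] [Nontrivial 𝔸]

/-- **`B8.Thm4ExistsBody cₑ (5dLB₀)` AT ONE MEMBER of `zdGF3` — THE EXISTENCE HALF OF THEOREM 4 (p. 88) modulo the THREE existence sockets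
at that member** (`SockP5base`, `SockP5`, `SockH59`; NO uniqueness socket): ONE threshold `cₑ(d, L, B₀, B₀′, cP)` chosen BEFORE the member;
«there exists a gauge transformation u satisfying (1.29) and such that U₁ = U′^{u⁻¹} satisfies (1.37), (1.38), (1.62)» — (1.29) `Restricted`,
(1.37) `C137` via the canonical masked exponent `mlogCfg` (`mlogCfg_spec` + `B8Eq142KLevelLocal.H42_of_inAx`), (1.38) `Landau`, (1.62) `C162`
with `logCfg`.  Proof = `B8LeafKnitZd3E.thm4Body_member_zd3E` verbatim with `B8Prop6CubeMemberExists.thm4Exists_concrete_uniform` in place of the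
whole driver and the uniqueness branch dropped. [cite: Balaban1985RegularSpaces, Thm 4 p.88, (1.29) p.81, (1.37)–(1.38) p.82, (1.62) p.87, Prop. 5 (1.107)–(1.108) p.94, (1.59) p.86] -/
theorem thm4ExistsBody_member_zd3 (hd2 : 2 ≤ d) {L : ℕ} (hL : 2 ≤ L) (β : ℝ) (len : Site d → ℝ) {B₀ B₀' cP : ℝ} (hB₀ : 0 < B₀)
    (hB₀' : 0 < B₀') (hB : 2 ≤ 5 * (d : ℝ) * L * B₀) (hcP : 0 < cP) :
    ∃ cₑ : ℝ, 0 < cₑ ∧ ∀ i : ZdIdx d L,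
      SockP5base (𝔸 := 𝔸) L B₀ B₀' cP i.η i.k i.Ω i.Λs → SockP5 (𝔸 := 𝔸) L B₀ B₀' cP i.η i.k i.Ω i.Λs →
      SockH59 (𝔸 := 𝔸) L B₀ B₀' cP i.η i.k i.Ω i.Λs i.Λb →
      B8.Thm4ExistsBody cₑ (5 * (d : ℝ) * L * B₀) (fun _ : Unit => (zdGF3 𝔸 L β len i).toGFData) := by
  have hL1 : 1 ≤ L := le_trans (by norm_num) hL
  have hd1 : 1 ≤ d := le_trans (by norm_num) hd2
  have hL' : (1 : ℝ) ≤ L := by exact_mod_cast hL1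
  obtain ⟨c₁, hc₁, H⟩ := thm4Exists_concrete_uniform (𝔸 := 𝔸) hd2 hL hB₀ hB₀' hB hcP
  obtain ⟨cw, hcw, hw⟩ := thm4_windows hd1 hL1 hB₀ hB₀' hB
  obtain ⟨cw', hcw', hw'⟩ := thm4_windows_extra (d := d) hL1
  refine ⟨min c₁ (min cw cw'), lt_min hc₁ (lt_min hcw hcw'), ?_⟩
  intro i SP5base SP5 SH59 _ α₀ α₁ hα₀ hα₁ hs U₀ P hInA _ hInAAx h166
  have hs₁ : α₀ + α₁ ≤ c₁ := hs.trans (min_le_left _ _)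
  have hsw : α₀ + α₁ ≤ cw := hs.trans ((min_le_right _ _).trans (min_le_left _ _))
  have hsw' : α₀ + α₁ ≤ cw' := hs.trans ((min_le_right _ _).trans (min_le_right _ _))
  obtain ⟨hP1, h34, hAx⟩ := hInAAx
  obtain ⟨h135, h66⟩ := h166
  subst hP1
  obtain ⟨u, hu, huS, h129, hLan, hleaf⟩ := H i.η i.hη i.k i.Ω i.hΩ i.Λs i.Λb i.hbox i.hclass
    SP5base SP5 SH59 α₀ α₁ hα₀ hα₁ hs₁ P.1.1 P.2.1 P.1.2 P.2.2 hInA h34 hAx h135 h66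
  -- windows for the (1.42) lemma
  obtain ⟨-, -, -, -, w5, w6, w7, -, w9, w10, -, -, -, -, -, -, -, -⟩ :=
    hw α₀ α₁ hα₀ hα₁ hsw (5 * (d : ℝ) * L * B₀ * (α₀ + α₁)) (8 * B₀' * (5 * (d : ℝ) * L * B₀) * (α₀ + α₁)) rfl rfl
  obtain ⟨w19, -⟩ := hw' α₀ α₁ hα₀ hα₁ hsw'
  have hcs0 : 0 ≤ 5 * (d : ℝ) * L * B₀ * (α₀ + α₁) := by positivity
  have hKS0 : 0 ≤ 2 * (L * (5 * (d : ℝ) * L * B₀ * (α₀ + α₁))) + 8 * (8 * B₀' * (5 * (d : ℝ) * L * B₀) * (α₀ + α₁)) := by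
    positivity
  have hcK : 5 * (d : ℝ) * L * B₀ * (α₀ + α₁) ≤
      2 * (L * (5 * (d : ℝ) * L * B₀ * (α₀ + α₁))) + 8 * (8 * B₀' * (5 * (d : ℝ) * L * B₀) * (α₀ + α₁)) := by
    have h₁ : (1 : ℝ) * (5 * (d : ℝ) * L * B₀ * (α₀ + α₁)) ≤ L * (5 * (d : ℝ) * L * B₀ * (α₀ + α₁)) :=
      mul_le_mul_of_nonneg_right hL' hcs0
    have h₂ : 0 ≤ 8 * (8 * B₀' * (5 * (d : ℝ) * L * B₀) * (α₀ + α₁)) := by positivity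
    linarith
  have hc16 : 16 * (5 * (d : ℝ) * L * B₀ * (α₀ + α₁)) ≤ 1 := by linarith
  -- the gauge-fixed field and its CANONICAL masked exponent
  have hW : mgauge P.1.1 u (mgauge P.1.1 u⁻¹ P.2.1) = P.2.1 := mgauge_mgauge_inv P.1.1 P.2.1 u
  have hWu : ∀ x κ, mgauge P.1.1 u⁻¹ P.2.1 x κ ∈ unitaryUnits 𝔸 := mem_unitaryUnits_of_mgauge_eq P.1.2 P.2.2 hu hW
  have hWA : ∀ j, j ≤ i.k → ∀ y τ, SideTouches (i.Ω j) y τ →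
      mgauge P.1.1 u⁻¹ P.2.1 y τ = cfgExp i.η (logCfg i.η (mgauge P.1.1 u⁻¹ P.2.1)) y τ ∧
        ‖logCfg i.η (mgauge P.1.1 u⁻¹ P.2.1) y τ‖ ≤ (5 * (d : ℝ) * L * B₀ * (α₀ + α₁)) * ((L : ℝ) ^ j * i.η)⁻¹ :=
    fun j hj y τ h => ⟨(hleaf j hj (y, τ) h).1, (hleaf j hj (y, τ) h).2.2⟩
  obtain ⟨hA'sa, hA'eq, hA'zero⟩ := mlogCfg_spec i.hη hL1 i.k P.1.1 hWu hcs0 hc16 i.Ω hWA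
  set A' := mlogCfg i.k i.η i.Ω (mgauge P.1.1 u⁻¹ P.2.1) with hA'_def
  have hA'bd : ∀ j, j ≤ i.k → ∀ y τ, SideTouches (i.Ω j) y τ →
      mgauge P.1.1 u⁻¹ P.2.1 y τ = cfgExp i.η A' y τ ∧
        ‖A' y τ‖ ≤ (2 * (L * (5 * (d : ℝ) * L * B₀ * (α₀ + α₁))) + 8 * (8 * B₀' * (5 * (d : ℝ) * L * B₀) * (α₀ + α₁))) *
          ((L : ℝ) ^ j * i.η)⁻¹ := by
    intro j hj y τ h
    obtain ⟨hAA, hWexp⟩ := hA'eq j hj y τ h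
    refine ⟨hWexp, ?_⟩
    rw [hAA]
    have hη0 : 0 ≤ i.η := i.hη.le
    exact ((hWA j hj y τ h).2).trans (mul_le_mul_of_nonneg_right hcK (by positivity))
  have h137 := B8Eq142KLevelLocal.H42_of_inAx hd2 i.hη hL i.k P.1.2 hα₀ hα₁ hKS0 w5 w6 w7 w9 w10 w19 i.Ω i.hΩ i.Λs i.Λb i.hbox
    i.hclass hInA h34 hAx h135 (fun m W => IsLandau138W L m i.η (i.Ω 0) (i.Λs m) P.1.1 W) i.k i.hk le_rfl u
    (mgauge P.1.1 u⁻¹ P.2.1) A' hu hW h129 (hLan i.hk) hA'sa hA'bd hA'zero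
  exact ⟨⟨u, hu, huS⟩, h129, h137, hLan i.hk, fun j hj b hb => hleaf j hj b hb⟩

/-- **`B8.Thm4UniqueBody c_u (5dLB₀)` AT ONE MEMBER of `zdGF3` — THE UNIQUENESS HALF OF THEOREM 4 («exactly one», proof p. 95) modulo
Proposition 5's repaired uniqueness socket `SockP5uE` at that member ALONE**: ONE threshold `c_u(d, L, B₀, B₀′, cu, cP)`; two restricted
`u₁, u₂ : GT` (unitary, `= 1` off `Ω₀`) with (1.37), (1.38), (1.62) for `U′^{u_i⁻¹}` are equal — §1 read through the member's fields
((1.62) `C162` with `logCfg` supplies the (1.62)-shape; (1.37) `C137` is not read; `htower`∕`hpart` are the member's laws).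
[cite: Balaban1985RegularSpaces, Thm 4 p.88 («exactly one»), proof p.95, Prop. 5 (1.109) p.94] -/
theorem thm4UniqueBody_member_zd3E (hd2 : 2 ≤ d) {L : ℕ} (hL : 2 ≤ L) (β : ℝ) (len : Site d → ℝ) {B₀ B₀' cu cP : ℝ} (hB₀ : 0 < B₀)
    (hB₀' : 0 < B₀') (hB : 2 ≤ 5 * (d : ℝ) * L * B₀) (hcu : 0 < cu) (hcP : 0 < cP) :
    ∃ c₁ : ℝ, 0 < c₁ ∧ ∀ i : ZdIdx d L, SockP5uE (𝔸 := 𝔸) L B₀ cP cu i.η i.k i.Ω i.Λs →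
      B8.Thm4UniqueBody c₁ (5 * (d : ℝ) * L * B₀) (fun _ : Unit => (zdGF3 𝔸 L β len i).toGFData) := by
  obtain ⟨c₁, hc₁, H⟩ := thm4Unique_concrete_uniformE (𝔸 := 𝔸) hd2 hL hB₀ hB₀' hB hcu hcP
  refine ⟨c₁, hc₁, ?_⟩
  intro i SP5u _ α₀ α₁ hα₀ hα₁ hs U₀ P hInA _ hInAAx h166 u₁ u₂ hR₁ _ hLan₁ h162₁ hR₂ _ hLan₂ h162₂
  obtain ⟨hP1, h34, hAx⟩ := hInAAx
  obtain ⟨h135, h66⟩ := h166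
  subst hP1
  apply Subtype.ext
  exact H i.η i.hη i.k i.Ω i.Λs i.htower i.hpart SP5u α₀ α₁ hα₀ hα₁ hs P.1.1 P.2.1 P.1.2 P.2.2 hInA h34 hAx h135 h66
    u₁.1 u₂.1 u₁.2.1 u₁.2.2 hR₁ hLan₁
    ⟨logCfg i.η (mgauge P.1.1 u₁.1⁻¹ P.2.1), fun j hj x κ h => ⟨(h162₁ j hj (x, κ) h).1, (h162₁ j hj (x, κ) h).2.2⟩⟩
    u₂.2.1 u₂.2.2 hR₂ hLan₂
    ⟨logCfg i.η (mgauge P.1.1 u₂.1⁻¹ P.2.1), fun j hj x κ h => ⟨(h162₂ j hj (x, κ) h).1, (h162₂ j hj (x, κ) h).2.2⟩⟩ i.hk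

end Member

/-! ## §3 The two halves on an index-mapped sub-family `fam₃ ∘ ι`, and `B8.Thm4Printed` reassembled from them -/

section Map

variable {𝔸 : Type} [CStarAlgebra 𝔸] [Nontrivial 𝔸]

/-- **THE EXISTENCE HALF OF THEOREM 4, `∃ cₑ > 0, B8.Thm4ExistsBody cₑ (5dLB₀)`, ON AN INDEX-MAPPED SUB-FAMILY `fam₃ ∘ ι`** of `zdGF3`
(`ι : J → ZdIdx d L`), from the THREE existence sockets on the image of `ι` only — the director's «Thm 4 EXISTENCE half `Thm4ExistsBody cₑ`»
on the family of record. [cite: Balaban1985RegularSpaces, Thm 4 p.88, Prop. 5 (1.107)–(1.108) p.94, (1.59) p.86] -/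
theorem thm4ExistsBody_zd3_map (hd2 : 2 ≤ d) {L : ℕ} (hL : 2 ≤ L) {β : ℝ} {len : Site d → ℝ} {B₀ B₀' cP : ℝ} (hB₀ : 0 < B₀)
    (hB₀' : 0 < B₀') (hB : 2 ≤ 5 * (d : ℝ) * L * B₀) (hcP : 0 < cP)
    {J : Type} (ι : J → ZdIdx d L)
    (SP5base : ∀ j : J, SockP5base (𝔸 := 𝔸) L B₀ B₀' cP (ι j).η (ι j).k (ι j).Ω (ι j).Λs)
    (SP5 : ∀ j : J, SockP5 (𝔸 := 𝔸) L B₀ B₀' cP (ι j).η (ι j).k (ι j).Ω (ι j).Λs)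
    (SH59 : ∀ j : J, SockH59 (𝔸 := 𝔸) L B₀ B₀' cP (ι j).η (ι j).k (ι j).Ω (ι j).Λs (ι j).Λb) :
    ∃ cₑ : ℝ, 0 < cₑ ∧ B8.Thm4ExistsBody cₑ (5 * (d : ℝ) * L * B₀) (fun j : J => (zdGF3 𝔸 L β len (ι j)).toGFData) := by
  obtain ⟨c, hc, H⟩ := thm4ExistsBody_member_zd3 (𝔸 := 𝔸) hd2 hL β len hB₀ hB₀' hB hcP
  exact ⟨c, hc, fun j => H (ι j) (SP5base j) (SP5 j) (SH59 j) ()⟩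

/-- **… with the two Proposition-5 existence sockets in the knit's FIXED-POINT CURRENCY** (`SockHFP₀`∕`SockHFP`) at the common threshold `cP`,
by the landed adapters below `min cP c₁` (`c₁` of `windows4`), `SockH59` by antitonicity. [cite: Balaban1985RegularSpaces, Thm 4 p.88, Prop. 5 (1.106)–(1.108) p.94, (1.59) p.86] -/
theorem thm4ExistsBody_zd3_of_HFP_map (hd2 : 2 ≤ d) {L : ℕ} (hL : 2 ≤ L) {β : ℝ} {len : Site d → ℝ} {B₀ B₀' cP : ℝ} (hB₀ : 0 < B₀)
    (hB₀' : 0 < B₀') (hB : 2 ≤ 5 * (d : ℝ) * L * B₀) (hcP : 0 < cP)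
    {J : Type} (ι : J → ZdIdx d L)
    (SHFP₀ : ∀ j : J, SockHFP₀ (𝔸 := 𝔸) L B₀ B₀' cP (ι j).η (ι j).k (ι j).Ω (ι j).Λs)
    (SHFP : ∀ j : J, SockHFP (𝔸 := 𝔸) L B₀ B₀' cP (ι j).η (ι j).k (ι j).Ω (ι j).Λs)
    (SH59 : ∀ j : J, SockH59 (𝔸 := 𝔸) L B₀ B₀' cP (ι j).η (ι j).k (ι j).Ω (ι j).Λs (ι j).Λb) :
    ∃ cₑ : ℝ, 0 < cₑ ∧ B8.Thm4ExistsBody cₑ (5 * (d : ℝ) * L * B₀) (fun j : J => (zdGF3 𝔸 L β len (ι j)).toGFData) := by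
  have hL1 : 1 ≤ L := le_trans (by norm_num) hL
  have hd1 : 1 ≤ d := le_trans (by norm_num) hd2
  obtain ⟨c₁, hc₁, hwin⟩ := windows4 hd1 hL1 hB₀ hB₀' hB
  have hm₁ : min cP c₁ ≤ cP := min_le_left _ _
  have hwin' : ∀ α₀ α₁ : ℝ, 0 < α₀ → 0 < α₁ → α₀ + α₁ ≤ min cP c₁ →
      8 * B₀' * (5 * (d : ℝ) * L * B₀) * (α₀ + α₁) ≤ 1 / 84 ∧ L * (5 * (d : ℝ) * L * B₀ * (α₀ + α₁)) ≤ 1 / 12 ∧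
        α₁ ≤ 1 / 4 ∧ 2 * α₁ ≤ 5 * (d : ℝ) * L * B₀ * (α₀ + α₁) :=
    fun α₀ α₁ hα₀ hα₁ hs => hwin α₀ α₁ hα₀ hα₁ (hs.trans (min_le_right _ _))
  exact thm4ExistsBody_zd3_map hd2 hL hB₀ hB₀' hB (lt_min hcP hc₁) ι
    (fun j => sockP5base_of_sockHFP₀ hd2 (ι j).hη hL1 hB₀.le hm₁ hwin' (SHFP₀ j))
    (fun j => sockP5_of_sockHFP hd2 (ι j).hη hL1 hB₀.le hm₁ hwin' (SHFP j))
    (fun j => sockH59_anti hm₁ (SH59 j))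

/-- **… and with THREE INDEPENDENT provider thresholds** `cF₀, cF, c59` (the form the providers deliver in). [cite: Balaban1985RegularSpaces, Thm 4 p.88 («there exists a constant c₁»), Prop. 5 p.94, (1.59) p.86] -/
theorem thm4ExistsBody_zd3_of_HFP₃_map (hd2 : 2 ≤ d) {L : ℕ} (hL : 2 ≤ L) {β : ℝ} {len : Site d → ℝ} {B₀ B₀' cF₀ cF c59 : ℝ}
    (hB₀ : 0 < B₀) (hB₀' : 0 < B₀') (hB : 2 ≤ 5 * (d : ℝ) * L * B₀) (hcF₀ : 0 < cF₀) (hcF : 0 < cF) (hc59 : 0 < c59)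
    {J : Type} (ι : J → ZdIdx d L)
    (SHFP₀ : ∀ j : J, SockHFP₀ (𝔸 := 𝔸) L B₀ B₀' cF₀ (ι j).η (ι j).k (ι j).Ω (ι j).Λs)
    (SHFP : ∀ j : J, SockHFP (𝔸 := 𝔸) L B₀ B₀' cF (ι j).η (ι j).k (ι j).Ω (ι j).Λs)
    (SH59 : ∀ j : J, SockH59 (𝔸 := 𝔸) L B₀ B₀' c59 (ι j).η (ι j).k (ι j).Ω (ι j).Λs (ι j).Λb) :
    ∃ cₑ : ℝ, 0 < cₑ ∧ B8.Thm4ExistsBody cₑ (5 * (d : ℝ) * L * B₀) (fun j : J => (zdGF3 𝔸 L β len (ι j)).toGFData) := by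
  set cP : ℝ := min (min cF₀ cF) c59 with hcPdef
  have hcP : 0 < cP := lt_min (lt_min hcF₀ hcF) hc59
  have h₁ : cP ≤ cF₀ := (min_le_left _ _).trans (min_le_left _ _)
  have h₂ : cP ≤ cF := (min_le_left _ _).trans (min_le_right _ _)
  have h₃ : cP ≤ c59 := min_le_right _ _
  exact thm4ExistsBody_zd3_of_HFP_map hd2 hL hB₀ hB₀' hB hcP ι (fun j => sockHFP₀_anti h₁ (SHFP₀ j))
    (fun j => sockHFP_anti h₂ (SHFP j)) (fun j => sockH59_anti h₃ (SH59 j))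

/-- **THE UNIQUENESS HALF OF THEOREM 4, `∃ c_u > 0, B8.Thm4UniqueBody c_u (5dLB₀)`, ON AN INDEX-MAPPED SUB-FAMILY `fam₃ ∘ ι`**, from
Proposition 5's repaired uniqueness socket `SockP5uE` on the image of `ι` ALONE. [cite: Balaban1985RegularSpaces, Thm 4 p.88 («exactly one»), proof p.95, Prop. 5 (1.109) p.94] -/
theorem thm4UniqueBody_zd3_mapE (hd2 : 2 ≤ d) {L : ℕ} (hL : 2 ≤ L) {β : ℝ} {len : Site d → ℝ} {B₀ B₀' cu cP : ℝ} (hB₀ : 0 < B₀)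
    (hB₀' : 0 < B₀') (hB : 2 ≤ 5 * (d : ℝ) * L * B₀) (hcu : 0 < cu) (hcP : 0 < cP)
    {J : Type} (ι : J → ZdIdx d L)
    (SP5u : ∀ j : J, SockP5uE (𝔸 := 𝔸) L B₀ cP cu (ι j).η (ι j).k (ι j).Ω (ι j).Λs) :
    ∃ c₁ : ℝ, 0 < c₁ ∧ B8.Thm4UniqueBody c₁ (5 * (d : ℝ) * L * B₀) (fun j : J => (zdGF3 𝔸 L β len (ι j)).toGFData) := by
  obtain ⟨c, hc, H⟩ := thm4UniqueBody_member_zd3E (𝔸 := 𝔸) hd2 hL β len hB₀ hB₀' hB hcu hcP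
  exact ⟨c, hc, fun j => H (ι j) (SP5u j) ()⟩

/-- **`B8.Thm4Printed (5dLB₀)` ON THE WHOLE FAMILY `zdGF3` REASSEMBLED FROM THE TWO HALVES** (`B8.thm4Printed_of_halves`, threshold
`min cₑ c_u`): the existence half from the three existence sockets, the uniqueness half from `SockP5uE` — the consistency certificate of the
split (the index-mapped form of this statement IS `B8LeafKnitZd3E.thm4Printed_zd3_mapE`, cited not restated; over the full index the socket
binders meet the junction flags J2∕J2′ — consumers use the `_map` halves on law-abiding sub-families).
[cite: Balaban1985RegularSpaces, Thm 4 p.88, proof pp.88–95, Prop. 5 (1.107)–(1.109) p.94, (1.59) p.86] -/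
theorem thm4Printed_zd3_of_halvesE (hd2 : 2 ≤ d) {L : ℕ} (hL : 2 ≤ L) {β : ℝ} {len : Site d → ℝ} {B₀ B₀' cu cP : ℝ}
    (hB₀ : 0 < B₀) (hB₀' : 0 < B₀') (hB : 2 ≤ 5 * (d : ℝ) * L * B₀) (hcu : 0 < cu) (hcP : 0 < cP)
    (SP5base : ∀ i : ZdIdx d L, SockP5base (𝔸 := 𝔸) L B₀ B₀' cP i.η i.k i.Ω i.Λs)
    (SP5 : ∀ i : ZdIdx d L, SockP5 (𝔸 := 𝔸) L B₀ B₀' cP i.η i.k i.Ω i.Λs)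
    (SH59 : ∀ i : ZdIdx d L, SockH59 (𝔸 := 𝔸) L B₀ B₀' cP i.η i.k i.Ω i.Λs i.Λb)
    (SP5u : ∀ i : ZdIdx d L, SockP5uE (𝔸 := 𝔸) L B₀ cP cu i.η i.k i.Ω i.Λs) :
    B8.Thm4Printed (5 * (d : ℝ) * L * B₀) (fun i : ZdIdx d L => (zdGF3 𝔸 L β len i).toGFData) := by
  obtain ⟨cₑ, hcₑ, hex⟩ := thm4ExistsBody_zd3_map (𝔸 := 𝔸) (β := β) (len := len) hd2 hL hB₀ hB₀' hB hcP id SP5base SP5 SH59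
  obtain ⟨cᵤ, hcᵤ, hun⟩ := thm4UniqueBody_zd3_mapE (𝔸 := 𝔸) (β := β) (len := len) hd2 hL hB₀ hB₀' hB hcu hcP id SP5u
  exact B8.thm4Printed_of_halves hcₑ hcᵤ hex hun

end Map

#print axioms thm4Unique_concrete_uniformE
#print axioms thm4ExistsBody_zd3_map
#print axioms thm4Printed_zd3_of_halvesE

end Literature.MathematicalPhysics.QuantumFieldTheory.Balaban1983to89.B8Thm4HalvesZd3

end
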